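import Literature.RingTheory.FittingIdeal.FittingLemma
import Mathlib.RingTheory.Kaehler.Polynomial
import Mathlib.LinearAlgebra.TensorProduct.Basis
import HarnessLib

/-!
# The Fitting ideal of the differentials of a hypersurface is the Jacobian ideal

Topic: `Literature/RingTheory/FittingIdeal`. The computation behind the scheme structure on the
singular locus of a relative hypersurface — in particular behind de Jong 1996, 2.21/2.23 ("Let
`Sing(f) ⊂ X` be the closed subscheme defined by the first Fitting ideal of the sheaf `Ω_{X/S}`
… the trace of `Sing(f)` on the scheme `Spec B` is given by the ideal `(u, v) ⊂ B`",
`B = A'⟦u, v⟧/(uv - h)`, computed on the algebra `B' = A'[u, v]/(uv - h)`, 3.3) — PROVED: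

* `Module.fittingIdeal_kaehlerDifferential_of_span_singleton` — **for a relative hypersurface
  `B = P/(F)`, `P = A[X₀, …, X_k]`, the `k`-th Fitting ideal of `Ω_{B/A}` is the Jacobian ideal
  `(∂F/∂X₀, …, ∂F/∂X_k) B`** (Eisenbud, *Commutative Algebra*, §16.1 with §20.2; the standard
  presentation `Ω_{B/A} = (⊕ B dXᵢ)/(dF)`), for any `B` with a surjection `P → B` of kernel `(F)`:
  the `d x̄ᵢ` generate `Ω_{B/A}`, and by the conormal sequence
  `I/I² → B ⊗_P Ω_{P/A} → Ω_{B/A} → 0` (Mathlib's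
  `KaehlerDifferential.exact_kerCotangentToTensor_mapBaseChange`) together with the basis `dXᵢ`
  of `Ω_{P/A}` (`KaehlerDifferential.mvPolynomialBasis`), every relation among them is a
  multiple of `(∂F/∂Xᵢ)ᵢ`; conclude by the one-relation case of Fitting's lemma
  (`Module.fittingIdeal_eq_span_range_of_single_relation`);
* `Module.fittingIdeal_kaehlerDifferential_quotient_span_singleton` — the same for
  `B = P ⧸ (F)` itself;
* `Module.fittingIdeal_kaehlerDifferential_node` — **de Jong's case**: for
  `F = X₀X₁ - C h` (`h ∈ A`), `Fitt₁(Ω_{B/A}) = (x̄₀, x̄₁)`.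

## Sources

* D. Eisenbud, *Commutative Algebra with a View Toward Algebraic Geometry*, GTM 150 (1995),
  §16.1 (Prop. 16.3, the conormal sequence; the presentation of `Ω` of an affine algebra),
  §20.2 (Fitting ideals). [Eisenbud1995]
* A. J. de Jong, *Smoothness, semi-stability and alterations*, Publ. Math. IHÉS 83 (1996), 2.21,
  2.23 (pp. 61–62), 3.3 (p. 63). [DeJong1996]
-/

namespace Literature.RingTheory.FittingIdeal

universe u v

open KaehlerDifferential MvPolynomial TensorProduct

variable {A : Type u} [CommRing A] {k : ℕ}

/-- In `Ω_{P/A}`, `P = A[X₀, …, X_k]`: `dF = ∑ᵢ (∂F/∂Xᵢ) dXᵢ`. [folklore] -/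
theorem KaehlerDifferential.D_mvPolynomial_eq_sum_pderiv (F : MvPolynomial (Fin (k + 1)) A) :
    D A (MvPolynomial (Fin (k + 1)) A) F =
      ∑ i, MvPolynomial.pderiv i F • D A (MvPolynomial (Fin (k + 1)) A) (MvPolynomial.X i) := by
  conv_lhs => rw [← (mvPolynomialBasis A (Fin (k + 1))).sum_repr
    (D A (MvPolynomial (Fin (k + 1)) A) F)]
  simp only [mvPolynomialBasis_repr_apply, mvPolynomialBasis_apply]

/-- **The Fitting ideal of the differentials of a relative hypersurface is its Jacobian ideal.**
Let `P = A[X₀, …, X_k]`, `F ∈ P`, and let `B` be an `A`-algebra with a surjection `P → B` of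
`A`-algebras with kernel `(F)` (so `B ≅ P/(F)`). Then `Ω_{B/A}` is generated by
`d x̄₀, …, d x̄_k` with the single relation `∑ᵢ (∂F/∂Xᵢ)‾ d x̄ᵢ = 0` generating all relations
(the conormal sequence `(F)/(F²) → B ⊗_P Ω_{P/A} → Ω_{B/A} → 0`, `Ω_{P/A}` free on the `dXᵢ`),
hence `Fitt_k(Ω_{B/A}) = ((∂F/∂X₀)‾, …, (∂F/∂X_k)‾)` (Eisenbud §16.1 and §20.2; Stacks 07Z6).
In particular `V(Fitt_k Ω_{B/A}) = V(F, ∂F/∂X₀, …, ∂F/∂X_k)` is the singular scheme of the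
hypersurface. [cite: Eisenbud1995, §16.1 and §20.2] -/
theorem Module.fittingIdeal_kaehlerDifferential_of_span_singleton
    (F : MvPolynomial (Fin (k + 1)) A) (B : Type v) [CommRing B] [Algebra A B]
    [Algebra (MvPolynomial (Fin (k + 1)) A) B] [IsScalarTower A (MvPolynomial (Fin (k + 1)) A) B]
    (hsurj : Function.Surjective (algebraMap (MvPolynomial (Fin (k + 1)) A) B))
    (hker : RingHom.ker (algebraMap (MvPolynomial (Fin (k + 1)) A) B) = Ideal.span {F}) :
    Module.fittingIdeal B (Ω[B⁄A]) k =
      Ideal.span (Set.range fun i =>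
        algebraMap (MvPolynomial (Fin (k + 1)) A) B (MvPolynomial.pderiv i F)) := by
  classical
  -- `P = A[X₀, …, X_k]`
  have hExact :=
    KaehlerDifferential.exact_kerCotangentToTensor_mapBaseChange A (MvPolynomial (Fin (k + 1)) A)
      B hsurj
  have hSurjΩ :=
    KaehlerDifferential.mapBaseChange_surjective A (MvPolynomial (Fin (k + 1)) A) B hsurj
  -- the basis `1 ⊗ dXᵢ` of `B ⊗_P Ω_{P/A}`
  let b : Module.Basis (Fin (k + 1)) B
      (B ⊗[MvPolynomial (Fin (k + 1)) A] Ω[MvPolynomial (Fin (k + 1)) A⁄A]) :=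
    (mvPolynomialBasis A (Fin (k + 1))).baseChange B
  have hb : ∀ i, b i = (1 : B) ⊗ₜ[MvPolynomial (Fin (k + 1)) A]
      D A (MvPolynomial (Fin (k + 1)) A) (MvPolynomial.X i) := fun i => by
    simp only [b, Module.Basis.baseChange_apply, mvPolynomialBasis_apply]
  -- the generating family `d x̄ᵢ` of `Ω_{B/A}`
  let y : Fin (k + 1) → Ω[B⁄A] := fun i =>
    D A B (algebraMap (MvPolynomial (Fin (k + 1)) A) B (MvPolynomial.X i))
  have hy_map : ∀ i, mapBaseChange A (MvPolynomial (Fin (k + 1)) A) B (b i) = y i :=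
    fun i => by rw [hb, mapBaseChange_tmul, one_smul, map_D]
  have hy : Submodule.span B (Set.range y) = ⊤ := by
    have hr : Set.range y =
        mapBaseChange A (MvPolynomial (Fin (k + 1)) A) B '' Set.range b := by
      ext ω
      simp only [Set.mem_range, Set.mem_image, exists_exists_eq_and, hy_map]
    rw [hr, Submodule.span_image, b.span_eq, Submodule.map_top, LinearMap.range_eq_top.2 hSurjΩ]
  -- the Jacobian vector
  let v : Fin (k + 1) → B := fun i =>
    algebraMap (MvPolynomial (Fin (k + 1)) A) B (MvPolynomial.pderiv i F)
  -- `1 ⊗ dF = ∑ vᵢ • bᵢ`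
  have hDF : (1 : B) ⊗ₜ[MvPolynomial (Fin (k + 1)) A] D A (MvPolynomial (Fin (k + 1)) A) F =
      ∑ i, v i • b i := by
    rw [KaehlerDifferential.D_mvPolynomial_eq_sum_pderiv F, tmul_sum]
    refine Finset.sum_congr rfl fun i _ => ?_
    rw [tmul_smul, hb, ← algebraMap_smul B (MvPolynomial.pderiv i F)]
  -- `F ↦ 0` in `B`
  have hF0 : algebraMap (MvPolynomial (Fin (k + 1)) A) B F = 0 := by
    rw [← RingHom.mem_ker, hker]
    exact Ideal.mem_span_singleton_self F
  -- the relation `∑ vᵢ • d x̄ᵢ = 0` (it is `d F̄ = 0`)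
  have hv : ∑ i, v i • y i = 0 := by
    have h := congrArg (mapBaseChange A (MvPolynomial (Fin (k + 1)) A) B) hDF
    rw [mapBaseChange_tmul, one_smul, map_D, hF0, map_zero, map_sum] at h
    simp only [map_smul, hy_map] at h
    exact h.symm
  -- every relation is a multiple of `v`
  have hgen : ∀ ρ : Fin (k + 1) → B, ∑ i, ρ i • y i = 0 → ρ ∈ Submodule.span B {v} := by
    intro ρ hρ
    set w : B ⊗[MvPolynomial (Fin (k + 1)) A] Ω[MvPolynomial (Fin (k + 1)) A⁄A] :=
      ∑ i, ρ i • b i with hw_def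
    have hw : mapBaseChange A (MvPolynomial (Fin (k + 1)) A) B w = 0 := by
      rw [hw_def, map_sum]
      simp only [map_smul, hy_map, hρ]
    obtain ⟨c, hc⟩ := (hExact w).1 hw
    obtain ⟨z, rfl⟩ := Ideal.toCotangent_surjective _ c
    rw [kerCotangentToTensor_toCotangent] at hc
    -- `z = p F`
    have hz : (z : MvPolynomial (Fin (k + 1)) A) ∈ Ideal.span {F} := hker.le z.2
    obtain ⟨p, hp⟩ := Ideal.mem_span_singleton'.1 hz
    -- `1 ⊗ d(pF) = p̄ • ∑ vᵢ • bᵢ`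
    have hexp : (1 : B) ⊗ₜ[MvPolynomial (Fin (k + 1)) A]
        D A (MvPolynomial (Fin (k + 1)) A) (z : MvPolynomial (Fin (k + 1)) A) =
        ∑ i, (algebraMap (MvPolynomial (Fin (k + 1)) A) B p * v i) • b i := by
      rw [← hp, Derivation.leibniz, tmul_add, tmul_smul, tmul_smul, hDF,
        ← algebraMap_smul B F, hF0, zero_smul, add_zero, ← algebraMap_smul B p, Finset.smul_sum]
      refine Finset.sum_congr rfl fun i _ => ?_
      rw [smul_smul]
    -- compare coordinates in the basis `b`
    have hρeq : ρ = fun i => algebraMap (MvPolynomial (Fin (k + 1)) A) B p * v i := by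
      have hlin := Fintype.linearIndependent_iff.1 b.linearIndependent
        (fun i => ρ i - algebraMap (MvPolynomial (Fin (k + 1)) A) B p * v i) (by
          simp only [sub_smul, Finset.sum_sub_distrib, ← hw_def, ← hexp, hc, sub_self])
      funext i
      exact sub_eq_zero.1 (hlin i)
    rw [hρeq]
    exact Submodule.mem_span_singleton.2 ⟨algebraMap (MvPolynomial (Fin (k + 1)) A) B p, rfl⟩
  exact Module.fittingIdeal_eq_span_range_of_single_relation y hy v hv hgen

/-- **`Fitt_k(Ω_{(P/(F))/A})` is the Jacobian ideal**, for the quotient ring itself: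
`P = A[X₀, …, X_k]`, `B = P ⧸ (F)`. [cite: Eisenbud1995, §16.1 and §20.2] -/
theorem Module.fittingIdeal_kaehlerDifferential_quotient_span_singleton
    (F : MvPolynomial (Fin (k + 1)) A) :
    Module.fittingIdeal (MvPolynomial (Fin (k + 1)) A ⧸ Ideal.span {F})
        (Ω[(MvPolynomial (Fin (k + 1)) A ⧸ Ideal.span {F})⁄A]) k =
      Ideal.span (Set.range fun i =>
        Ideal.Quotient.mk (Ideal.span {F}) (MvPolynomial.pderiv i F)) :=
  Module.fittingIdeal_kaehlerDifferential_of_span_singleton F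
    (MvPolynomial (Fin (k + 1)) A ⧸ Ideal.span {F}) Ideal.Quotient.mk_surjective Ideal.mk_ker

/-- **de Jong 1996, 2.23/3.3: the singular scheme of the split node.** For `h ∈ A` and
`B = A[u, v]/(uv - h)`, the first Fitting ideal of `Ω_{B/A}` is `(ū, v̄)`: the Jacobian ideal of
`uv - h` is `(v, u)` ("the trace of `Sing(f)` on the scheme `Spec B` is given by the ideal
`(u, v) ⊂ B`. This lies over the closed subscheme of `Spec A` given by the element … `h`").
Here `u = X₀`, `v = X₁` in `A[X₀, X₁] = MvPolynomial (Fin (1 + 1)) A`.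
[cite: DeJong1996, 2.23, p. 62] -/
theorem Module.fittingIdeal_kaehlerDifferential_node (h : A) :
    Module.fittingIdeal
        (MvPolynomial (Fin (1 + 1)) A ⧸
          Ideal.span {(X 0 * X 1 - C h : MvPolynomial (Fin (1 + 1)) A)})
        (Ω[(MvPolynomial (Fin (1 + 1)) A ⧸
          Ideal.span {(X 0 * X 1 - C h : MvPolynomial (Fin (1 + 1)) A)})⁄A]) 1 =
      Ideal.span {Ideal.Quotient.mk
          (Ideal.span {(X 0 * X 1 - C h : MvPolynomial (Fin (1 + 1)) A)}) (X 0),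
        Ideal.Quotient.mk
          (Ideal.span {(X 0 * X 1 - C h : MvPolynomial (Fin (1 + 1)) A)}) (X 1)} := by
  classical
  rw [Module.fittingIdeal_kaehlerDifferential_quotient_span_singleton]
  have h0 : MvPolynomial.pderiv (0 : Fin (1 + 1))
      (X 0 * X 1 - C h : MvPolynomial (Fin (1 + 1)) A) = X 1 := by
    simp [MvPolynomial.pderiv_X]
  have h1 : MvPolynomial.pderiv (1 : Fin (1 + 1))
      (X 0 * X 1 - C h : MvPolynomial (Fin (1 + 1)) A) = X 0 := by
    simp [MvPolynomial.pderiv_X]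
  congr 1
  ext b
  simp only [Set.mem_range, Set.mem_insert_iff, Set.mem_singleton_iff]
  constructor
  · rintro ⟨i, rfl⟩
    refine Fin.cases ?_ (fun j => ?_) i
    · exact Or.inr (by rw [h0])
    · have hj : j = 0 := Fin.eq_zero j
      subst hj
      exact Or.inl (by rw [show Fin.succ (0 : Fin 1) = (1 : Fin (1 + 1)) from rfl, h1])
  · rintro (rfl | rfl)
    · exact ⟨1, by rw [h1]⟩
    · exact ⟨0, by rw [h0]⟩

end Literature.RingTheory.FittingIdeal
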